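import Summits.QuantumFields.YangMills.Theorems.ToronSmallBallOwnAxisShiftCountingGen
import Summits.QuantumFields.YangMills.Theorems.ToronSmallBallOwnAxisShiftWindow
import Summits.QuantumFields.YangMills.Theorems.QuantileBitPuritySectorTwistedCore
import HarnessLib

/-!
# The own-axis sheet shift: the generic off-core strip estimate at fixed `β`, `L`, any ring length `n + 1 ≤ 2L`, any sector

Support module (`--supports` stmt-QuantumFields-24092, `QuantileBitPurity.HolonomyLevyWindowDeepR`; seat ym-dw-p1 g15).  GENERIC VERSION of
`ToronSmallBallOwnAxisShiftWindow` (`…_of_numerics`, which served ⟨24089⟩): the same seven numeric inequalities (stated for the LONGER ring `2L`, so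
that `ToronSmallBallOwnAxisShiftNumerics` applies unchanged) give, for every sector `z` with `z 0 = false`, every measurable own-axis-invariant slice
functional `f` and every ring of `n + 1 ≤ 2L` slices (`n ≥ 1`),

★ `sectorWeight_stripGen_le_rpow_of_numerics`: `W_z(𝟙_{|polDist U₀ − f U₀| ≤ w, c₀ < polDist U₀}) ≤ β^(−a) · Z_phys(n+1)`;

and, for the sectors WITH `x`-twist (`z 0 = true`), the bad-field inequality alone gives

★ `sectorWeight_twisted_le_rpow_of_numerics`: `W_z(𝟙_{polDist U₀ ≤ c'}) ≤ β^(−a)/2 · Z_phys(n+1)` for `c' < 2 − L(n+1)η`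
(`TT.sectorWeight_indicator_polDist_le_of_twisted`).

HONEST FRAMING: fixed-lattice bookkeeping; nothing about infinite volume, the continuum limit or the Clay gap.  No `sorry`, no new axiom, no new
definition.  References: [cite: Luscher1983, §2]; [cite: tHooft1979]; [cite: MontvayMunster1994, (3.145)].
-/

set_option autoImplicit false

noncomputable section

open MeasureTheory Set Function
open scoped BigOperators
open Literature.MathematicalPhysics.QuantumLattice (su2Quat)
open Literature.MathematicalPhysics.QuantumFieldTheory hiding su2Quat_mul SU2

namespace Summit.QuantumFields.YangMills.Theorems.FemtoTransferGap.OwnAxis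

open ClassShift FlatSheet
open Summit.QuantumFields.YangMills.Theorems.FemtoTransferGap.TT

variable {L : ℕ} [NeZero L]

/-! ## §1 Sector totals and the bad-field numerics -/

/-- Every sector weight is at most `8 Z_phys`. [cite: MontvayMunster1994, (3.145)] -/
theorem sectorWeight_one_le (β : ℝ) (n : ℕ) (z : Fin 3 → Bool) :
    sectorWeight (L := L) β n z (fun _ _ => (1 : ℝ)) ≤ 8 * physTraceSucc L β n := by
  rw [physTraceSucc_eq_sum_sectorWeight]
  have h := Finset.single_le_sum (f := fun w : Fin 3 → Bool => sectorWeight (L := L) β n w fun _ _ => (1 : ℝ))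
    (fun w _ => sectorWeight_nonneg β n w fun _ _ => zero_le_one) (Finset.mem_univ z)
  linarith

/-- The bad-field numerics: `(n+1)(e^{−βη²/2} + e^{−βη²/2})(β^{N_bad})^{n+1} · Z ≤ β^{−a}/2 · Z` for `n + 1 ≤ 2L`, `β ≥ 1`, given the
bad-field inequality `hG` stated for the longer ring `2L`. [folklore] -/
theorem bad_numerics_mul_le {n : ℕ} (hn2 : n + 1 ≤ 2 * L) {β a η : ℝ} (hβ1 : 1 ≤ β)
    (hG : 4 * L * Real.exp (-(β * η ^ 2 / 2)) * (β ^ (315 * L ^ 3)) ^ (2 * L) ≤ β ^ (-a) / 2) {Z : ℝ} (hZ : 0 ≤ Z) :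
    ((n : ℝ) + 1) * (Real.exp (-(β / 2 * η ^ 2)) + Real.exp (-(β * η ^ 2 / 2))) *
        (β ^ (8 * Fintype.card (Plaquette 3 L) + 97 * Fintype.card (Edge 3 L))) ^ (n + 1) * Z ≤ β ^ (-a) / 2 * Z := by
  have hnr : (n : ℝ) + 1 ≤ 2 * L := by
    have : ((n + 1 : ℕ) : ℝ) ≤ ((2 * L : ℕ) : ℝ) := by exact_mod_cast hn2
    push_cast at this; linarith
  have hpow : (β ^ (8 * Fintype.card (Plaquette 3 L) + 97 * Fintype.card (Edge 3 L))) ^ (n + 1) ≤ (β ^ (315 * L ^ 3)) ^ (2 * L) := by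
    rw [badExponent_eq]
    exact pow_le_pow_right₀ (one_le_pow₀ hβ1) hn2
  rw [show β / 2 * η ^ 2 = β * η ^ 2 / 2 by ring]
  have hee : 0 ≤ Real.exp (-(β * η ^ 2 / 2)) + Real.exp (-(β * η ^ 2 / 2)) := by positivity
  have hP0 : 0 ≤ (β ^ (8 * Fintype.card (Plaquette 3 L) + 97 * Fintype.card (Edge 3 L))) ^ (n + 1) := by positivity
  have hn0 : 0 ≤ (n : ℝ) + 1 := by positivity
  calc ((n : ℝ) + 1) * (Real.exp (-(β * η ^ 2 / 2)) + Real.exp (-(β * η ^ 2 / 2))) *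
        (β ^ (8 * Fintype.card (Plaquette 3 L) + 97 * Fintype.card (Edge 3 L))) ^ (n + 1) * Z
      ≤ (2 * L) * (Real.exp (-(β * η ^ 2 / 2)) + Real.exp (-(β * η ^ 2 / 2))) * (β ^ (315 * L ^ 3)) ^ (2 * L) * Z := by
        gcongr
    _ = (4 * L * Real.exp (-(β * η ^ 2 / 2)) * (β ^ (315 * L ^ 3)) ^ (2 * L)) * Z := by ring
    _ ≤ β ^ (-a) / 2 * Z := mul_le_mul_of_nonneg_right hG hZ

/-- `Z_phys ≥ 0` in the window regime (`n ≥ 1`, `β ≥ 200`). [folklore] -/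
theorem physTraceSucc_nonneg_of {n : ℕ} (hn1 : 1 ≤ n) {β : ℝ} (hβ : 200 ≤ β) : 0 ≤ physTraceSucc L β n := by
  have h := floor_le_physTraceSucc (L := L) hn1 (by linarith) (floor_const_le.trans hβ)
  exact le_trans (by positivity) h

/-! ## §2 Twisted sectors -/

/-- ★ **Twisted sectors** (`z 0 = true`): the sub-level event `{polDist U₀ ≤ c'}` with `c' < 2 − L(n+1)η` lies in the bad fields, so it carries at
most `β^{−a}/2 · Z_phys(n+1)` (`n ≥ 1`, `n + 1 ≤ 2L`, `β ≥ 200`, the bad-field inequality). [cite: Luscher1983, §2] [cite: tHooft1979] -/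
theorem sectorWeight_twisted_le_rpow_of_numerics {z : Fin 3 → Bool} (hz : z 0 = true) {n : ℕ} (hn1 : 1 ≤ n) (hn2 : n + 1 ≤ 2 * L)
    {β a η c' : ℝ} (hβ : 200 ≤ β) (hη : 0 ≤ η) (hc' : c' < 2 - L * ((n + 1) * η))
    (hG : 4 * L * Real.exp (-(β * η ^ 2 / 2)) * (β ^ (315 * L ^ 3)) ^ (2 * L) ≤ β ^ (-a) / 2) :
    sectorWeight β n z (fun Us _ => {U : GaugeConfig 3 L SU2 | polDist U ≤ c'}.indicator (fun _ => (1 : ℝ)) (Us 0)) ≤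
      β ^ (-a) / 2 * physTraceSucc L β n := by
  have h := sectorWeight_indicator_polDist_le_of_twisted (L := L) hz hn1 (by linarith) (floor_const_le.trans hβ) (η ^ 2) hη hc'
  exact h.trans (bad_numerics_mul_le (L := L) hn2 (by linarith) hG (physTraceSucc_nonneg_of (L := L) hn1 hβ))

/-! ## §3 Untwisted sectors: the generic strip -/

set_option maxHeartbeats 800000 in
/-- ★ **The generic off-core strip estimate at fixed `β`, `L` from numeric inequalities** (ring of `n+1 ≤ 2L` slices, `n ≥ 1`, sector `z` with
`z 0 = false`, own-axis-invariant measurable `f`). [cite: Luscher1983, §2] [cite: MontvayMunster1994, (3.145)] -/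
theorem sectorWeight_stripGen_le_rpow_of_numerics {z : Fin 3 → Bool} (hz : z 0 = false) {f : GaugeConfig 3 L SU2 → ℝ} (hfm : Measurable f)
    (hfinv : ∀ (θ : ℝ) (U : GaugeConfig 3 L SU2), f (ownShift θ U) = f U) {n : ℕ} (hn1 : 1 ≤ n) (hn2 : n + 1 ≤ 2 * L)
    {β a η w c₀ σ θ' : ℝ} {K : ℕ} (hβ : 200 ≤ β) (hη : 0 < η) (hw : 0 < w) (hθ' : 5 * w < θ')
    (hσ : 0 < σ) (hσ1 : σ ≤ 1) (hfl : 4 * (L * (L * η)) ≤ c₀ / 2 - σ) (hK : 1 ≤ K) (hKσ : K * θ' ≤ σ / 2)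
    (hQ : 12 * β * (L : ℝ) ^ 4 * ((K * θ' * (2 * (L * η) / σ)) ^ 2 + 2 * (K * θ' * (2 * (L * η) / σ)) * η) ≤ 1)
    (hJ : 4 * (L : ℝ) ^ 4 * (K * θ' / σ) ≤ 1 / 2)
    (hG : 4 * L * Real.exp (-(β * η ^ 2 / 2)) * (β ^ (315 * L ^ 3)) ^ (2 * L) ≤ β ^ (-a) / 2)
    (hKa : 32 * Real.exp 1 / K ≤ β ^ (-a) / 2) :
    sectorWeight β n z (fun Us _ =>
        {U : GaugeConfig 3 L SU2 | |polDist U - f U| ≤ w ∧ c₀ < polDist U}.indicator (fun _ => (1 : ℝ)) (Us 0)) ≤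
      β ^ (-a) * physTraceSucc L β n := by
  have hL1 : 1 ≤ L := NeZero.one_le
  have hβ0 : 0 ≤ β := by linarith
  have hβ1 : 1 ≤ β := by linarith
  have hnr : (n : ℝ) ≤ 2 * L := by
    have : ((n + 1 : ℕ) : ℝ) ≤ ((2 * L : ℕ) : ℝ) := by exact_mod_cast hn2
    push_cast at this; linarith
  have hn1r : ((n + 1 : ℕ) : ℝ) ≤ ((2 * L : ℕ) : ℝ) := by exact_mod_cast hn2
  have hθ'0 : 0 < θ' := by linarith
  -- the floor hypothesis
  have hsq : Real.sqrt (η ^ 2) = η := Real.sqrt_sq hη.le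
  have hσle : σ ≤ c₀ / 2 - 2 * (L * (L * Real.sqrt (η ^ 2))) - n * (L * η) := by
    rw [hsq]
    have : (n : ℝ) * (L * η) ≤ 2 * (L * (L * η)) := by
      have h0 : 0 ≤ L * η := by positivity
      nlinarith
    linarith
  have hKπ : (K : ℝ) * θ' ≤ Real.pi / 2 := by linarith [Real.pi_gt_three]
  -- the uniform domination constant `C = 2e`
  set C : ℝ := 2 * Real.exp 1 with hC
  have hC0 : 0 ≤ C := by positivity
  have hCθ : ∀ θ : ℝ, |θ| ≤ K * θ' →
      Real.exp (β * ((n + 1 : ℕ) * (Fintype.card (Plaquette 3 L) * ((|θ| * (2 * (L * Real.sqrt (η ^ 2)) / σ)) ^ 2 + 2 * (|θ| * (2 * (L * Real.sqrt (η ^ 2)) / σ)) * Real.sqrt (η ^ 2)) +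
          Fintype.card (Edge 3 L) * ((|θ| * (2 * (L * η) / σ)) ^ 2 + 2 * (|θ| * (2 * (L * η) / σ)) * η)))) *
        ((((1 - |θ| / σ) ^ 2)⁻¹) ^ (Finset.univ.filter (fun x : Site 3 L => x 0 = 0)).card) ^ (n + 1) ≤ C := by
    intro θ hθ
    rw [hsq, card_plaquette_add_card_edge_mul]
    have hθ0 : 0 ≤ |θ| := abs_nonneg θ
    set X : ℝ := 2 * (L * η) / σ with hX
    have hX0 : 0 ≤ X := by positivity
    have hb : (|θ| * X) ^ 2 + 2 * (|θ| * X) * η ≤ (K * θ' * X) ^ 2 + 2 * (K * θ' * X) * η := by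
      have h1 : |θ| * X ≤ K * θ' * X := mul_le_mul_of_nonneg_right hθ hX0
      have h2 : 0 ≤ |θ| * X := by positivity
      nlinarith
    have hb0 : 0 ≤ (|θ| * X) ^ 2 + 2 * (|θ| * X) * η := by positivity
    have hexp : β * (((n + 1 : ℕ) : ℝ) * (6 * (L : ℝ) ^ 3 * ((|θ| * X) ^ 2 + 2 * (|θ| * X) * η))) ≤ 1 := by
      calc β * (((n + 1 : ℕ) : ℝ) * (6 * (L : ℝ) ^ 3 * ((|θ| * X) ^ 2 + 2 * (|θ| * X) * η)))
          ≤ β * (((2 * L : ℕ) : ℝ) * (6 * (L : ℝ) ^ 3 * ((|θ| * X) ^ 2 + 2 * (|θ| * X) * η))) := by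
            refine mul_le_mul_of_nonneg_left (mul_le_mul_of_nonneg_right hn1r (by positivity)) hβ0
        _ = 12 * β * (L : ℝ) ^ 4 * ((|θ| * X) ^ 2 + 2 * (|θ| * X) * η) := by push_cast; ring
        _ ≤ 12 * β * (L : ℝ) ^ 4 * ((K * θ' * X) ^ 2 + 2 * (K * θ' * X) * η) := mul_le_mul_of_nonneg_left hb (by positivity)
        _ ≤ 1 := hQ
    have hE : Real.exp (β * (((n + 1 : ℕ) : ℝ) * (6 * (L : ℝ) ^ 3 * ((|θ| * X) ^ 2 + 2 * (|θ| * X) * η)))) ≤ Real.exp 1 := Real.exp_le_exp.2 hexp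
    set x : ℝ := |θ| / σ with hx
    have hx0 : 0 ≤ x := by positivity
    have hxK : x ≤ K * θ' / σ := div_le_div_of_nonneg_right hθ hσ.le
    have hKx : (K : ℝ) * θ' / σ ≤ 1 / 2 := by rw [div_le_iff₀ hσ]; linarith
    have hx1 : x ≤ 1 := by linarith
    have h1x : 0 < 1 - x := by linarith
    have hbase : 1 ≤ ((1 - x) ^ 2)⁻¹ := (one_le_inv₀ (by positivity)).2 (pow_le_one₀ h1x.le (by linarith))
    set y : ℝ := ((1 - x) ^ 2)⁻¹ with hy
    have hy0 : 0 ≤ y := by positivity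
    have hstep0 : (y ^ (Finset.univ.filter (fun x : Site 3 L => x 0 = 0)).card) ^ (n + 1) ≤
        (y ^ (Finset.univ.filter (fun x : Site 3 L => x 0 = 0)).card) ^ (2 * L) :=
      pow_le_pow_right₀ (one_le_pow₀ hbase) hn2
    have hstep1 : (y ^ (Finset.univ.filter (fun x : Site 3 L => x 0 = 0)).card) ^ (2 * L) ≤ (y ^ (L ^ 3)) ^ (2 * L) :=
      pow_le_pow_left₀ (by positivity) (pow_le_pow_right₀ hbase card_plane_le) (2 * L)
    have hstep2 : (y ^ (L ^ 3)) ^ (2 * L) = ((1 - x) ^ (4 * L ^ 4))⁻¹ := by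
      rw [hy, ← pow_mul, inv_pow, ← pow_mul]
      congr 2
      ring
    have hm : ((4 * L ^ 4 : ℕ) : ℝ) * x ≤ 1 / 2 := by
      have h4 : ((4 * L ^ 4 : ℕ) : ℝ) * x ≤ 4 * (L : ℝ) ^ 4 * (K * θ' / σ) := by
        push_cast; exact mul_le_mul_of_nonneg_left hxK (by positivity)
      linarith
    have hJ' : (y ^ (Finset.univ.filter (fun x : Site 3 L => x 0 = 0)).card) ^ (n + 1) ≤ 2 := by
      rw [hstep2] at hstep1
      exact hstep0.trans (hstep1.trans (inv_pow_one_sub_le_two hx1 hm))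
    have hfin := mul_le_mul hE hJ' (by positivity) (Real.exp_pos _).le
    have hCe : Real.exp 1 * 2 = C := by rw [hC]; ring
    rw [hCe] at hfin
    exact hfin
  -- counting
  have hmain := sectorWeight_stripGen_le (L := L) hz hfm hfinv hβ0 n hK hσ hσ1 hσle hw.le hθ' hKσ hKπ hC0 hCθ
  -- the bad fields
  have hbad := sectorWeight_indicator_compl_goodEvent_le_floor (L := L) hn1 (by linarith) (floor_const_le.trans hβ) z (η ^ 2) hη.le
  have hZ0 : 0 ≤ physTraceSucc L β n := physTraceSucc_nonneg_of (L := L) hn1 hβ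
  have hbad' : sectorWeight β n z (fun Us g => (goodEvent (L := L) n z (η ^ 2) η)ᶜ.indicator (fun _ => (1 : ℝ)) (g, Us)) ≤
      β ^ (-a) / 2 * physTraceSucc L β n :=
    hbad.trans (bad_numerics_mul_le (L := L) hn2 hβ1 hG hZ0)
  -- the sector total
  have hW1 := sectorWeight_one_le (L := L) β n z
  have hcount : 2 * (C / K) * sectorWeight (L := L) β n z (fun _ _ => (1 : ℝ)) ≤ β ^ (-a) / 2 * physTraceSucc L β n := by
    have hCK : 0 ≤ 2 * (C / K) := by positivity
    calc 2 * (C / K) * sectorWeight (L := L) β n z (fun _ _ => (1 : ℝ)) ≤ 2 * (C / K) * (8 * physTraceSucc L β n) :=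
          mul_le_mul_of_nonneg_left hW1 hCK
      _ = (32 * Real.exp 1 / K) * physTraceSucc L β n := by rw [hC]; ring
      _ ≤ β ^ (-a) / 2 * physTraceSucc L β n := mul_le_mul_of_nonneg_right hKa hZ0
  linarith

end Summit.QuantumFields.YangMills.Theorems.FemtoTransferGap.OwnAxis

end
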